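import Summits.MatrixMultiplication.OmegaCensus.TriangleTorusShearedImbalance

/-!
# The exact defect identity of a punctured sheared torus and the sharp one-sided bound `54·Δ ≤ 48n − 24` (kernel)

ω-census `pub-omega`, family (b3), seat pub-omega-group gen 34.  Framing: lottery ticket; floor = certified bounds/negative
ranges.  VALUE: kernel form of the cell's 'Corollary D' (RESULTS-g32 §0: the imbalance of a triangle factor is an explicit
sum of LOCAL weights along the hole's zigzag column) for the sheared tori of `ShearedFactor n a s`, and the resulting sharper
ONE-SIDED imbalance bound; NOT progress on ω.  It replaces `3·|Δ| ≤ 4n + 2` (`ShearedFactor.three_mul_abs_sub_le`) by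
`54·Δ ≤ 48n − 24`, i.e. `Δ ≤ (8n − 4)/9`, which is what closes the two exceptional square tori `ℤ₈²`, `ℤ₁₀²` of
`ThreeSetNoPartThreeCorollaries` and improves `|A| ≤ 12·ord + 7` to `|A| ≤ 8·ord − 3` (sequel `ThreeSetTilingPartThreeSharp`).

* `dfun_lconcat_sum` — the defect functional of a window is the sum of the defect functionals of its slots.
* **`Qz_step_hole_eq`** — exact hole-column step: `Qz c − Qz (c−1) − 3·colCharge c = C + Σ_{i<n} ω(j₀+i)` with the hexagon
  constant `C = 3a_ℓ + det(c_ℓ, ρᵗ c_ℓ)` and the CELL WEIGHTS `ω(j) = dfun t c_ℓ (Σ inPiece c j)`.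
* **`imbalance_eq_defect`** — `54·(#up − #down) = −(C + Σ_{i<n} ω(j₀+i))` (hole of column `0` at height `j₀`).
* `defect_const_one/two` — `C = 36` for `t = 1`, `C = −18` for `t = 2`; `cell_weight_lower_one/two` — `ω(j) ≥ −36`, except
  `ω(j) ≥ −72` for `t = 1` at relative height `j − j₀ ≡ 1 (mod 3)` (finite tables, `decide`; the weights depend only on
  `t`, `(j − j₀) mod 3` and the block type of the cell, cf. the exact check on all tilings of `ℤ₇², ℤ₈²` in HOME/pub-omega-group-g34).
* **`imbalance_le_sharp`** — `54·(#up − #down) ≤ 48n − 24` (`3 ∤ n`, `2 ≤ n`, `1 ≤ a`, column `0` has a hole).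
-/

namespace Summit.MatrixMultiplication.OmegaCensus.TriangleTorus

open Finset

/-- The defect functional of a window is the sum over its slots. [folklore] -/
theorem dfun_lconcat_sum (t : ZMod 3) (c : ℤ × ℤ) (f : ℤ → List (ℤ × ℤ)) (a : ℤ) (m : ℕ) :
    dfun t c (lconcat f a m).sum = ∑ i ∈ range m, dfun t c (f (a + i)).sum := by
  induction m with
  | zero => simp [dfun_zero]
  | succ m ih => rw [lconcat_succ, List.sum_append, dfun_add, ih, sum_range_succ]

/-- The hexagon constant for the period rotation `ρ`: `36`. [folklore] -/
theorem defect_const_one (c j : ℤ) :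
    3 * (hol (hexLoop c j)).a + det₂ (hol (hexLoop c j)).v (rot 1 (hol (hexLoop c j)).v) = 36 := by
  simp only [hexLoop, sD, sV, sH, tw_eq]
  push_cast
  generalize (c : ZMod 3) = a
  generalize (j : ZMod 3) = b
  revert a b
  decide

/-- The hexagon constant for the period rotation `ρ²`: `−18`. [folklore] -/
theorem defect_const_two (c j : ℤ) :
    3 * (hol (hexLoop c j)).a + det₂ (hol (hexLoop c j)).v (rot 2 (hol (hexLoop c j)).v) = -18 := by
  simp only [hexLoop, sD, sV, sH, tw_eq]
  push_cast
  generalize (c : ZMod 3) = a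
  generalize (j : ZMod 3) = b
  revert a b
  decide

namespace ShearedFactor

open TriangleFactor (trot trot_ne_zero)

variable {n a : ℕ} {s : ℤ}

/-- **Exact hole-column step.**  If column `c` has its hole at height `j₀`, then
`Qz c − Qz (c−1) − 3·colCharge c = C + Σ_{i<n} ω(j₀ + i)`, `ω(j) = dfun t c_ℓ (Σ inPiece c j)`. [folklore] -/
theorem Qz_step_hole_eq (T : ShearedFactor n a s) (h3 : ¬ 3 ∣ n) (hn : 1 ≤ n) (c j₀ : ℤ) (hc : T.hole c j₀ = true) :
    T.Qz c - T.Qz (c - 1) - 3 * T.colCharge c =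
      (3 * (hol (hexLoop c j₀)).a + det₂ (hol (hexLoop c j₀)).v (rot (trot n) (hol (hexLoop c j₀)).v)) +
      ∑ i ∈ range n, dfun (trot n) (hol (hexLoop c j₀)).v (T.inPiece c (j₀ + i)).sum := by
  obtain ⟨m, hm⟩ : ∃ m : ℕ, n = m + 1 := ⟨n - 1, by omega⟩
  have hb0 : T.bdry c j₀ := by
    obtain ⟨hP, -, -, -, -, -, -, -⟩ := six_cases (T.cover c j₀)
    obtain ⟨-, -, hut, hdt, -, -⟩ := hP.1 hc
    exact ⟨hut, hdt⟩
  have hb' : T.bdry c (j₀ + 1 + m) := by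
    rw [show j₀ + 1 + (m : ℤ) = j₀ + n by rw [hm]; push_cast; ring]; exact (T.bdry_add_right c j₀).2 hb0
  have L := T.ladder_hole_run c j₀ m hc hb' (fun i hi => by
    by_contra h
    have h' : T.hole c (j₀ + 1 + i) = true := by simpa using h
    have hd := T.hole_uniq c j₀ (j₀ + 1 + i) hc h'
    rw [show j₀ + 1 + (i : ℤ) - j₀ = 1 + i by ring] at hd
    have := Int.le_of_dvd (by omega) hd
    omega)
  rw [show j₀ + (m : ℤ) = j₀ + n - 1 by rw [hm]; push_cast; ring, TriangleFactor.rung_period, ← hm,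
    mul_assoc (st (sV c (j₀ - 1))) (hol (hexLoop c j₀)) (hol (T.InL c j₀ n)),
    mul_assoc (st (sV c (j₀ - 1))) (hol (hexLoop c j₀) * hol (T.InL c j₀ n)) (cen _),
    mul_assoc (hol (hexLoop c j₀)) (hol (T.InL c j₀ n)) (cen _)] at L
  have L' := eq_mul_inv_of_mul_eq L
  have key : T.Qz c = Q (trot n) (hol (hexLoop c j₀) * (hol (T.InL c j₀ n) * cen (T.kc c j₀ n))) := by
    rw [← T.Q_OutL h3 c j₀, L', Q_conj _ (trot_ne_zero h3)]
  have hsum : 3 * det₂ (hol (hexLoop c j₀)).v (hol (T.InL c j₀ n)).v +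
      det₂ (hol (hexLoop c j₀)).v (rot (trot n) (hol (T.InL c j₀ n)).v) +
      det₂ (hol (T.InL c j₀ n)).v (rot (trot n) (hol (hexLoop c j₀)).v) =
      ∑ i ∈ range n, dfun (trot n) (hol (hexLoop c j₀)).v (T.inPiece c (j₀ + i)).sum := by
    rw [hol_v_eq_sum (T.InL c j₀ n), InL, ← dfun_lconcat_sum]
    rfl
  rw [key, ← mul_assoc, Q_mul_cen, Q_mul_left, T.Q_InL h3 c j₀, T.kc_any c j₀, hsum]
  ring

/-- **Exact defect identity.**  If column `0` has its hole at height `j₀` (`3 ∤ n`, `1 ≤ a`):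
`54·(#up − #down) = −(C + Σ_{i<n} ω(j₀ + i))`. [folklore] -/
theorem imbalance_eq_defect (T : ShearedFactor n a s) (h3 : ¬ 3 ∣ n) (hn : 1 ≤ n) (ha : 1 ≤ a) (j₀ : ℤ)
    (hc : T.hole 0 j₀ = true) :
    54 * (T.upCount - T.dnCount) =
      -((3 * (hol (hexLoop 0 j₀)).a + det₂ (hol (hexLoop 0 j₀)).v (rot (trot n) (hol (hexLoop 0 j₀)).v)) +
        ∑ i ∈ range n, dfun (trot n) (hol (hexLoop 0 j₀)).v (T.inPiece 0 (j₀ + i)).sum) := by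
  -- telescoping
  have tel : ∑ i ∈ range a, (T.Qz ((i + 1 : ℕ) - 1 : ℤ) - T.Qz ((i : ℕ) - 1 : ℤ)) = 0 := by
    rw [Finset.sum_range_sub (fun i : ℕ => T.Qz ((i : ℤ) - 1)) a]
    have := T.Qz_add_left h3 (-1)
    rw [show (-1 : ℤ) + a = (a : ℤ) - 1 by ring] at this
    push_cast; linarith
  set D : ℤ := T.Qz 0 - T.Qz (0 - 1) - 3 * T.colCharge 0 with hD
  have hDeq := T.Qz_step_hole_eq h3 hn 0 j₀ hc
  have per : ∀ i ∈ range a, (T.Qz ((i + 1 : ℕ) - 1 : ℤ) - T.Qz ((i : ℕ) - 1 : ℤ)) =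
      3 * T.colCharge i + (if i = 0 then D else 0) := by
    intro i hi
    rw [mem_range] at hi
    rcases Nat.eq_zero_or_pos i with rfl | hpos
    · simp [hD]
    · rw [if_neg hpos.ne']
      have hfree : ∀ j, T.hole i j = false := by
        intro j
        by_contra h
        have h' : T.hole i j = true := by simpa using h
        have hdvd := T.hole_col i j h'
        have := Int.le_of_dvd (by exact_mod_cast hpos) hdvd
        omega
      have := T.Qz_step h3 i hfree
      rw [show (((i + 1 : ℕ) : ℤ) - 1) = i by push_cast; ring, add_zero, this]; ring
  have hδ : ∑ i ∈ range a, (if i = 0 then D else 0) = D := by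
    rw [Finset.sum_eq_single 0 (fun b _ hb => if_neg hb) (fun h => absurd (mem_range.2 (by omega)) h), if_pos rfl]
  rw [Finset.sum_congr rfl per, Finset.sum_add_distrib, ← Finset.mul_sum, hδ, sum_colCharge] at tel
  rw [← hDeq]
  linarith

/-- **Cell weights are `≥ −36` for the period rotation `ρ²`.** [folklore] -/
theorem cell_weight_lower_two (T : ShearedFactor n a s) (c j₀ j : ℤ) :
    -36 ≤ dfun 2 (hol (hexLoop c j₀)).v (T.inPiece c j).sum := by
  unfold inPiece fin0 fin1
  split_ifs <;>
  · simp only [List.cons_append, List.nil_append, List.sum_cons, List.sum_nil, add_zero, hexLoop, dfun, sD, sV, sH,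
      tw_eq]
    push_cast
    generalize (c : ZMod 3) = x
    generalize (j : ZMod 3) = y
    generalize (j₀ : ZMod 3) = z
    revert x y z
    decide

/-- **Cell weights for the period rotation `ρ`**: `≥ −72` at relative height `j − j₀ ≡ 1 (mod 3)`, `≥ −36` otherwise.
[folklore] -/
theorem cell_weight_lower_one (T : ShearedFactor n a s) (c j₀ j : ℤ) :
    -(if ((j - j₀ : ℤ) : ZMod 3) = 1 then 72 else 36) ≤ dfun 1 (hol (hexLoop c j₀)).v (T.inPiece c j).sum := by
  unfold inPiece fin0 fin1
  split_ifs <;>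
  · first
    | (simp only [List.cons_append, List.nil_append, List.sum_cons, List.sum_nil, add_zero, hexLoop, dfun, sD, sV, sH,
        tw_eq]
       push_cast at *
       revert ‹_ = (1 : ZMod 3)›
       generalize (c : ZMod 3) = x
       generalize (j : ZMod 3) = y
       generalize (j₀ : ZMod 3) = z
       revert x y z
       decide)
    | (simp only [List.cons_append, List.nil_append, List.sum_cons, List.sum_nil, add_zero, hexLoop, dfun, sD, sV, sH,
        tw_eq]
       push_cast at *
       revert ‹¬ _ = (1 : ZMod 3)›
       generalize (c : ZMod 3) = x
       generalize (j : ZMod 3) = y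
       generalize (j₀ : ZMod 3) = z
       revert x y z
       decide)

/-- The number of `i < n` with `i ≡ 1 (mod 3)` is `(n + 1) / 3`. [folklore] -/
theorem card_filter_mod_three_eq_one (n : ℕ) : ((range n).filter fun i => i % 3 = 1).card = (n + 1) / 3 := by
  induction n with
  | zero => simp
  | succ n ih =>
    rw [Finset.range_add_one, filter_insert]
    split_ifs with h
    · rw [card_insert_of_notMem (by simp), ih]; omega
    · rw [ih]; omega

/-- **Sharp one-sided imbalance bound.**  If column `0` has a hole (`3 ∤ n`, `2 ≤ n`, `1 ≤ a`):
`54·(#up − #down) ≤ 48n − 24`. [folklore] -/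
theorem imbalance_le_sharp (T : ShearedFactor n a s) (h3 : ¬ 3 ∣ n) (hn : 2 ≤ n) (ha : 1 ≤ a) (j₀ : ℤ)
    (hc : T.hole 0 j₀ = true) : 54 * (T.upCount - T.dnCount) ≤ 48 * n - 24 := by
  rw [T.imbalance_eq_defect h3 (by omega) ha j₀ hc]
  -- `trot n` is `1` or `2`
  have ht : trot n = 1 ∨ trot n = 2 := by
    have hne := trot_ne_zero h3
    generalize trot n = t at hne ⊢
    revert t; decide
  rcases ht with ht | ht
  · -- `t = 1`: `C = 36`, weights `≥ −36` resp. `≥ −72` on the residue class `1`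
    rw [ht, defect_const_one]
    have hcell : ∀ i ∈ range n, -(36 + 36 * (if i % 3 = 1 then (1 : ℤ) else 0)) ≤
        dfun 1 (hol (hexLoop 0 j₀)).v (T.inPiece 0 (j₀ + i)).sum := by
      intro i _
      have h := T.cell_weight_lower_one 0 j₀ (j₀ + i)
      rw [show j₀ + (i : ℤ) - j₀ = i by ring] at h
      have e : ((((i : ℕ) : ℤ) : ZMod 3) = 1) ↔ i % 3 = 1 := by
        rw [Int.cast_natCast]
        constructor
        · intro h1
          have := (ZMod.natCast_eq_natCast_iff' i 1 3).1 (by simpa using h1)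
          simpa using this
        · intro h1
          have := (ZMod.natCast_eq_natCast_iff' i 1 3).2 (by simpa using h1)
          simpa using this
      by_cases hi : i % 3 = 1
      · rw [if_pos hi]; rw [if_pos (e.2 hi)] at h; linarith
      · rw [if_neg hi]; rw [if_neg (fun h' => hi (e.1 h'))] at h; linarith
    have hle := Finset.sum_le_sum hcell
    have e : ∑ i ∈ range n, -(36 + 36 * (if i % 3 = 1 then (1 : ℤ) else 0)) =
        -(36 * (n : ℤ) + 36 * (((n + 1) / 3 : ℕ) : ℤ)) := by
      rw [sum_neg_distrib, sum_add_distrib, sum_const, card_range, ← mul_sum, sum_boole, card_filter_mod_three_eq_one,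
        nsmul_eq_mul]
      ring
    rw [e] at hle
    have h3' : (((n + 1) / 3 : ℕ) : ℤ) * 3 ≤ n + 1 := by exact_mod_cast Nat.div_mul_le_self (n + 1) 3
    linarith
  · -- `t = 2`: `C = −18`, all weights `≥ −36`
    rw [ht, defect_const_two]
    have hcell : ∀ i ∈ range n, (-36 : ℤ) ≤ dfun 2 (hol (hexLoop 0 j₀)).v (T.inPiece 0 (j₀ + i)).sum :=
      fun i _ => T.cell_weight_lower_two 0 j₀ (j₀ + i)
    have hle := Finset.sum_le_sum hcell
    rw [sum_const, card_range, nsmul_eq_mul] at hle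
    -- `t = 2` means `n ≡ 1 (mod 3)`, so `n ≥ 4`
    have hdvd : (3 : ℤ) ∣ -(n : ℤ) - 2 := by
      refine (ZMod.intCast_zmod_eq_zero_iff_dvd _ 3).1 ?_
      have h := ht
      unfold TriangleFactor.trot at h
      push_cast at h ⊢
      rw [h]
      decide
    have hn' : (4 : ℤ) ≤ n := by omega
    linarith

end ShearedFactor

end Summit.MatrixMultiplication.OmegaCensus.TriangleTorus
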